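import Summits.HodgeConjecture.HodgeConjecture.Theorems.NikulinTwinTransportNikulinSerreCarrierBlockCriterionLattice
import Mathlib.Analysis.Complex.Basic

/-!
# Route AnchorTransport — `AnchorExistence` (stmt-HodgeConjecture-1077), line `Sketch`, CM floor:
# the Hodge–Riemann sign on the transcendental `(1,1)`-classes of a projective K3 surface

The positivity input of the polarization of the transcendental Hodge structure `T(S)_ℚ` of a
projective K3 surface, in the marking picture (`Λ_ℂ = ℂ²²`, `k3Form`): the K3 lattice
`Λ = E₈(−1)^{⊕2} ⊕ U^{⊕3}` has signature `(3, 19)` (Huybrechts, *Lectures on K3 Surfaces*, Ch. 1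
Prop. 3.5), the period `x` (`(x.x) = 0`, `(x.x̄) > 0`) spans with its conjugate a positive real
plane, and an ample class `u` (`(u.x) = 0`, `(u.u) > 0`) a third positive direction; hence the
form is NEGATIVE definite on the real vectors orthogonal to `x, x̄, u` — in particular
`(v.v̄) < 0` for every non-zero `v ∈ Λ_ℂ` orthogonal to `x`, `x̄` and `u` (the transcendental
`(1,1)`-classes), which is the second Hodge–Riemann relation `-(v.v̄) > 0` on `T^{1,1}`
(Huybrechts Ch. 3 §1.2, Def. 1.6 and Lemma 3.1: "`T(X)` is a polarizable irreducible Hodge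
structure"). The real statement — `n₊(Λ_ℝ) ≤ 3`: a vector orthogonal to a positive three-space
with non-negative square vanishes — is the tree's `k3Real_eq_zero_of_perp_posThree` (crux
`NikulinSerreCarrier`, with `twistorChain_posFamily_of_orthogonal` of `K3TwistorLines`); this file
adds the passage from `Λ_ℂ` to `Λ_ℝ` (real and imaginary parts, the expansion of `( . )` on
`a + ib`, the period and orthogonality relations in real terms) and concludes
(`re_k3Form_self_star_neg`).

## References

* [Huybrechts2016K3] D. Huybrechts, Lectures on K3 Surfaces, CUP 2016, Ch. 1 Prop. 3.5 (signature
  `(3,19)`), Ch. 3 §1.2 Def. 1.6 and Lemma 3.3.1, Ch. 6 §1.1 (the period domain), Ch. 14 §0.3 (vi).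
-/

noncomputable section

set_option linter.dupNamespace false

open Module
open Literature.AlgebraicGeometry.Surfaces
open Summit.HodgeConjecture.HodgeConjecture.Theorems.NikulinSerreCarrier.NeronSeveriIntertwiner

namespace Summit.HodgeConjecture.HodgeConjecture.Theorems.AnchorExistenceCMFloor

/-- The real K3 form `(u.w) = Σ uᵢ Λᵢⱼ wⱼ` on `Λ_ℝ = ℝ²²` (Mathlib's `Matrix.toBilin'`, as in
`K3TwistorLines`). Local notation only. -/
local notation "BR" => (Matrix.toBilin' (k3Gram.map (Int.cast : ℤ → ℝ)) : LinearMap.BilinForm ℝ (K3Index → ℝ))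

/-! ### The real statement: `n₊(Λ_ℝ) ≤ 3` -/

/-- **The real K3 form is negative definite on the orthogonal complement of three pairwise
orthogonal positive vectors** (signature `(3, 19)`): a non-zero `w` orthogonal to `p, q, r` has
`(w.w) < 0` — the tree's `k3Real_eq_zero_of_perp_posThree` (a vector orthogonal to a positive
three-space with `(w.w) ≥ 0` vanishes) applied to the positive triple `(p, q, r)`
(`twistorChain_posFamily_of_orthogonal`). [cite: Huybrechts2016K3, Ch. 1 Prop. 3.5 and Ch. 14 §0.3 (vi)] -/
theorem k3Real_self_neg_of_orthogonal {p q r w : K3Index → ℝ}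
    (hp : 0 < BR p p) (hq : 0 < BR q q) (hr : 0 < BR r r)
    (hpq : BR p q = 0) (hpr : BR p r = 0) (hqr : BR q r = 0)
    (hwp : BR w p = 0) (hwq : BR w q = 0) (hwr : BR w r = 0) (hw : w ≠ 0) :
    BR w w < 0 := by
  by_contra hww
  rw [not_lt] at hww
  refine hw (k3Real_eq_zero_of_perp_posThree rfl ![p, q, r]
    (twistorChain_posFamily_of_orthogonal _ k3RForm_comm hpq hpr hqr hp hq hr) (fun i => ?_) hww)
  fin_cases i
  · simpa [k3RForm_comm p w] using hwp
  · simpa [k3RForm_comm q w] using hwq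
  · simpa [k3RForm_comm r w] using hwr

/-- The real K3 form on integral vectors is the integral lattice form. [folklore] -/
theorem k3RForm_intCast_intCast (v w : K3Index → ℤ) :
    BR (fun i => (v i : ℝ)) (fun i => (w i : ℝ)) = ((∑ i, ∑ j, v i * k3Gram i j * w j : ℤ) : ℝ) := by
  rw [k3RForm_apply]
  simp only [Int.cast_sum, Int.cast_mul]

/-! ### From `Λ_ℂ` to `Λ_ℝ`: real and imaginary parts -/

/-- The real part of a vector of `Λ_ℂ`. [folklore] -/
def reVec (v : K3Index → ℂ) : K3Index → ℝ := fun i => (v i).re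

/-- The imaginary part of a vector of `Λ_ℂ`. [folklore] -/
def imVec (v : K3Index → ℂ) : K3Index → ℝ := fun i => (v i).im

/-- `v = Re v + i Im v`. [folklore] -/
theorem eq_reVec_add_imVec (v : K3Index → ℂ) :
    v = (fun i => (reVec v i : ℂ)) + Complex.I • fun i => (imVec v i : ℂ) := by
  funext i
  simp only [Pi.add_apply, Pi.smul_apply, smul_eq_mul, reVec, imVec]
  rw [mul_comm, Complex.re_add_im]

/-- `v̄ = Re v - i Im v`. [folklore] -/
theorem star_eq_reVec_sub_imVec (v : K3Index → ℂ) :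
    star v = (fun i => (reVec v i : ℂ)) - Complex.I • fun i => (imVec v i : ℂ) := by
  funext i
  simp only [Pi.star_apply, Pi.sub_apply, Pi.smul_apply, smul_eq_mul, reVec, imVec]
  apply Complex.ext <;> simp

/-- **The K3 form on `a + ib`, `c + id` in terms of the real form.** [folklore] -/
theorem k3Form_expand (a b c d : K3Index → ℝ) :
    k3Form ((fun i => (a i : ℂ)) + Complex.I • fun i => (b i : ℂ))
        ((fun i => (c i : ℂ)) + Complex.I • fun i => (d i : ℂ)) =
      ((BR a c - BR b d : ℝ) : ℂ) + Complex.I * ((BR b c + BR a d : ℝ) : ℂ) := by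
  rw [k3Form_add_left, k3Form_add_right, k3Form_add_right, k3Form_smul_left, k3Form_smul_left,
    k3Form_smul_right, k3Form_smul_right, k3Form_ofReal_eq_k3RForm, k3Form_ofReal_eq_k3RForm, k3Form_ofReal_eq_k3RForm,
    k3Form_ofReal_eq_k3RForm]
  push_cast
  have hI : Complex.I * Complex.I = -1 := Complex.I_mul_I
  linear_combination (↑(BR b d) : ℂ) * hI

/-- The K3 form on `a + ib`, `c - id` in terms of the real form. [folklore] -/
theorem k3Form_expand_sub (a b c d : K3Index → ℝ) :
    k3Form ((fun i => (a i : ℂ)) + Complex.I • fun i => (b i : ℂ))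
        ((fun i => (c i : ℂ)) - Complex.I • fun i => (d i : ℂ)) =
      ((BR a c + BR b d : ℝ) : ℂ) + Complex.I * ((BR b c - BR a d : ℝ) : ℂ) := by
  have h : ((fun i => (c i : ℂ)) - Complex.I • fun i => (d i : ℂ)) =
      (fun i => (c i : ℂ)) + Complex.I • fun i => (((-d) i : ℝ) : ℂ) := by
    funext i
    simp only [Pi.sub_apply, Pi.smul_apply, Pi.add_apply, Pi.neg_apply, smul_eq_mul, Complex.ofReal_neg]
    ring
  rw [h, k3Form_expand]
  simp only [map_neg]
  push_cast
  ring

/-- A real vector `c` is `c + i·0`. [folklore] -/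
theorem realCast_eq (c : K3Index → ℝ) :
    (fun i => (c i : ℂ)) = (fun i => (c i : ℂ)) + Complex.I • fun i => ((0 : K3Index → ℝ) i : ℂ) := by
  funext i
  simp

/-- Real and imaginary parts of `s + it` for real `s, t`. [folklore] -/
theorem re_im_of_eq {s t : ℝ} {z : ℂ} (h : (s : ℂ) + Complex.I * (t : ℂ) = z) : s = z.re ∧ t = z.im := by
  constructor
  · have := congrArg Complex.re h
    simpa using this
  · have := congrArg Complex.im h
    simpa using this

/-- **`(v.v̄) = (Re v.Re v) + (Im v.Im v)`** is real. [cite: Huybrechts2016K3, Ch. 6 §1.1] -/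
theorem k3Form_self_star (v : K3Index → ℂ) :
    k3Form v (star v) = ((BR (reVec v) (reVec v) + BR (imVec v) (imVec v) : ℝ) : ℂ) := by
  have h := k3Form_expand_sub (reVec v) (imVec v) (reVec v) (imVec v)
  rw [← star_eq_reVec_sub_imVec v, ← eq_reVec_add_imVec v] at h
  rw [h, k3RForm_comm (imVec v) (reVec v), sub_self]
  push_cast
  ring

/-- **The period in real terms**: `(x.x) = 0` and `(x̄.x) > 0` give `(Re x.Re x) = (Im x.Im x) > 0`
and `(Re x.Im x) = 0`. [cite: Huybrechts2016K3, Ch. 6 §1.1] -/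
theorem period_real_parts {x : K3Index → ℂ} (hxx : k3Form x x = 0) (hxpos : 0 < (k3Form (star x) x).re) :
    0 < BR (reVec x) (reVec x) ∧ 0 < BR (imVec x) (imVec x) ∧
      BR (reVec x) (imVec x) = 0 := by
  have h1 : k3Form x x = ((BR (reVec x) (reVec x) - BR (imVec x) (imVec x) : ℝ) : ℂ) +
      Complex.I * ((BR (imVec x) (reVec x) + BR (reVec x) (imVec x) : ℝ) : ℂ) := by
    conv_lhs => rw [eq_reVec_add_imVec x]
    exact k3Form_expand _ _ _ _
  rw [hxx] at h1
  obtain ⟨e1, e2⟩ := re_im_of_eq h1.symm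
  rw [Complex.zero_re] at e1
  rw [Complex.zero_im] at e2
  rw [k3Form_comm, k3Form_self_star, Complex.ofReal_re] at hxpos
  rw [k3RForm_comm (imVec x)] at e2
  refine ⟨by linarith, by linarith, by linarith⟩

/-- **Orthogonality to `x` and `x̄` in real terms**: `Re v, Im v ⊥ Re x, Im x`.
[cite: Huybrechts2016K3, Ch. 6 §1.1] -/
theorem orth_real_parts {v x : K3Index → ℂ} (hvx : k3Form v x = 0) (hvx' : k3Form v (star x) = 0) :
    BR (reVec v) (reVec x) = 0 ∧ BR (reVec v) (imVec x) = 0 ∧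
      BR (imVec v) (reVec x) = 0 ∧ BR (imVec v) (imVec x) = 0 := by
  have h1 : k3Form v x = ((BR (reVec v) (reVec x) - BR (imVec v) (imVec x) : ℝ) : ℂ) +
      Complex.I * ((BR (imVec v) (reVec x) + BR (reVec v) (imVec x) : ℝ) : ℂ) := by
    conv_lhs => rw [eq_reVec_add_imVec v, eq_reVec_add_imVec x]
    exact k3Form_expand _ _ _ _
  have h2 : k3Form v (star x) = ((BR (reVec v) (reVec x) + BR (imVec v) (imVec x) : ℝ) : ℂ) +
      Complex.I * ((BR (imVec v) (reVec x) - BR (reVec v) (imVec x) : ℝ) : ℂ) := by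
    conv_lhs => rw [eq_reVec_add_imVec v, star_eq_reVec_sub_imVec x]
    exact k3Form_expand_sub _ _ _ _
  rw [hvx] at h1
  rw [hvx'] at h2
  obtain ⟨e1, e2⟩ := re_im_of_eq h1.symm
  obtain ⟨e3, e4⟩ := re_im_of_eq h2.symm
  rw [Complex.zero_re] at e1 e3
  rw [Complex.zero_im] at e2 e4
  refine ⟨by linarith, by linarith, by linarith, by linarith⟩

/-- **Orthogonality to a real vector in real terms**: `Re v, Im v ⊥ c`. [folklore] -/
theorem orth_real_of_real {v : K3Index → ℂ} {c : K3Index → ℝ} (h : k3Form v (fun i => (c i : ℂ)) = 0) :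
    BR (reVec v) c = 0 ∧ BR (imVec v) c = 0 := by
  have h1 : k3Form v (fun i => (c i : ℂ)) = ((BR (reVec v) c - BR (imVec v) 0 : ℝ) : ℂ) +
      Complex.I * ((BR (imVec v) c + BR (reVec v) 0 : ℝ) : ℂ) := by
    conv_lhs => rw [eq_reVec_add_imVec v, realCast_eq c]
    exact k3Form_expand _ _ _ _
  rw [h, map_zero, map_zero, sub_zero, add_zero] at h1
  obtain ⟨e1, e2⟩ := re_im_of_eq h1.symm
  rw [Complex.zero_re] at e1
  rw [Complex.zero_im] at e2
  exact ⟨e1, e2⟩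

/-- A vector of `Λ_ℂ` with vanishing real and imaginary parts is zero. [folklore] -/
theorem eq_zero_of_reVec_imVec {v : K3Index → ℂ} (hr : reVec v = 0) (hi : imVec v = 0) : v = 0 := by
  funext i
  apply Complex.ext
  · exact congrFun hr i
  · exact congrFun hi i

/-- **The second Hodge–Riemann relation on the transcendental `(1,1)`-classes, marking picture.**
For a period `x ∈ Λ_ℂ` (`(x.x) = 0`, `(x̄.x) > 0`), an ample lattice vector `u` (`(u.x) = 0`,
`(u.u) > 0`) and a non-zero `v ∈ Λ_ℂ` orthogonal to `x`, `x̄` and `u`: `(v.v̄) < 0`.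
[cite: Huybrechts2016K3, Ch. 3 §1.2 Def. 1.6 and Lemma 3.3.1; Ch. 1 Prop. 3.5] -/
theorem re_k3Form_self_star_neg {x v : K3Index → ℂ} {u : K3Index → ℤ}
    (hxx : k3Form x x = 0) (hxpos : 0 < (k3Form (star x) x).re)
    (hux : k3Form (fun i => (u i : ℂ)) x = 0) (hupos : (0 : ℤ) < ∑ i, ∑ j, u i * k3Gram i j * u j)
    (hvx : k3Form v x = 0) (hvx' : k3Form v (star x) = 0) (hvu : k3Form v (fun i => (u i : ℂ)) = 0)
    (hv0 : v ≠ 0) : (k3Form v (star v)).re < 0 := by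
  obtain ⟨hp, hq, hpq⟩ := period_real_parts hxx hxpos
  obtain ⟨hvrxr, hvrxi, hvixr, hvixi⟩ := orth_real_parts hvx hvx'
  set uR : K3Index → ℝ := fun i => (u i : ℝ) with huR
  have hucast : (fun i => (u i : ℂ)) = fun i => (uR i : ℂ) := by
    funext i
    simp [huR]
  rw [hucast] at hux hvu
  obtain ⟨hvru, hviu⟩ := orth_real_of_real hvu
  -- `u ⊥ Re x, Im x` and `(u.u) > 0`
  have hux' : k3Form (fun i => (uR i : ℂ)) x = ((BR uR (reVec x) - BR 0 (imVec x) : ℝ) : ℂ) +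
      Complex.I * ((BR 0 (reVec x) + BR uR (imVec x) : ℝ) : ℂ) := by
    conv_lhs => rw [realCast_eq uR, eq_reVec_add_imVec x]
    exact k3Form_expand _ _ _ _
  rw [hux, map_zero, LinearMap.zero_apply, LinearMap.zero_apply, sub_zero, zero_add] at hux'
  obtain ⟨hur, hui⟩ := re_im_of_eq hux'.symm
  rw [Complex.zero_re] at hur
  rw [Complex.zero_im] at hui
  have hr : 0 < BR uR uR := by
    rw [huR, k3RForm_intCast_intCast]
    exact_mod_cast hupos
  -- the signature argument for `Re v` and `Im v`
  have key : ∀ w : K3Index → ℝ, BR w (reVec x) = 0 → BR w (imVec x) = 0 → BR w uR = 0 →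
      BR w w ≤ 0 ∧ (w ≠ 0 → BR w w < 0) := by
    intro w h₁ h₂ h₃
    have hneg : w ≠ 0 → BR w w < 0 := fun hw =>
      k3Real_self_neg_of_orthogonal hp hq hr hpq (by rw [k3RForm_comm, ← hur]) (by rw [k3RForm_comm, ← hui])
        h₁ h₂ h₃ hw
    refine ⟨?_, hneg⟩
    by_cases hw : w = 0
    · simp [hw]
    · exact (hneg hw).le
  obtain ⟨hle1, hlt1⟩ := key (reVec v) hvrxr hvrxi hvru
  obtain ⟨hle2, hlt2⟩ := key (imVec v) hvixr hvixi hviu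
  rw [k3Form_self_star, Complex.ofReal_re]
  by_cases h1 : reVec v = 0
  · have h2 : imVec v ≠ 0 := fun h2 => hv0 (eq_zero_of_reVec_imVec h1 h2)
    have := hlt2 h2
    linarith
  · have := hlt1 h1
    linarith

/-- `(v.v̄)` is real. [cite: Huybrechts2016K3, Ch. 6 §1.1] -/
theorem im_k3Form_self_star (v : K3Index → ℂ) : (k3Form v (star v)).im = 0 := by
  rw [k3Form_self_star, Complex.ofReal_im]

end Summit.HodgeConjecture.HodgeConjecture.Theorems.AnchorExistenceCMFloor

end
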